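import Mathlib
import HarnessLib

/-!
# Real-variable lemmas for the Nash moment recursion

Support file for the proof of Bass–Levin 2002, Theorem 1.1
(`Literature.Probability.Process.bassLevin_thm_1_1`): the two elementary real-variable facts that
close the entropy–moment argument (our replacement of Bass–Levin Thm 2.8).

* `le_sqrt_mul_of_forall_pos` : if `X ≤ t A + B/(4t)` for all `t > 0` (`A, B ≥ 0`) then
  `X ≤ √(A B)`;
* `moment_recursion_bound` : if a sequence `M ≥ 1` with `M 0 = 1` has bounded increments
  `M (k+1) ≤ M k + C₁` and satisfies the dyadic recursion
  `M (4m) ≤ M (2m) + K m^{1/4} √(max 0 (A + L log (M (4m) / (2m)^{1/4})))` (`m ≥ 1`), then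
  `M k ≤ U k^{1/4}` for all `k ≥ 1`.

[folklore] (Nash 1958, Part II, the moment bound.)

## References
* J. Nash, *Continuity of solutions of parabolic and elliptic equations*, Amer. J. Math. 80
  (1958) 931–954.
-/

noncomputable section

namespace Literature.Probability.Process

open scoped BigOperators

/-- If `X ≤ t A + B / (4 t)` for every `t > 0`, with `A, B ≥ 0`, then `X ≤ √(A B)`. [folklore] -/
theorem le_sqrt_mul_of_forall_pos {X A B : ℝ} (hA : 0 ≤ A) (hB : 0 ≤ B)
    (h : ∀ t : ℝ, 0 < t → X ≤ t * A + B / (4 * t)) : X ≤ Real.sqrt (A * B) := by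
  rcases hA.eq_or_lt with hA0 | hApos
  · -- A = 0: X ≤ B/(4t) for all t, hence X ≤ 0
    rw [← hA0, zero_mul, Real.sqrt_zero]
    by_contra hX
    push Not at hX
    have ht : 0 < (B + 1) / X := div_pos (by linarith) hX
    have := h ((B + 1) / X) ht
    rw [← hA0, mul_zero, zero_add] at this
    have h2 : B / (4 * ((B + 1) / X)) = B * X / (4 * (B + 1)) := by
      field_simp
    rw [h2] at this
    have h3 : B * X / (4 * (B + 1)) < X := by
      rw [div_lt_iff₀ (by positivity)]; nlinarith
    linarith
  rcases hB.eq_or_lt with hB0 | hBpos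
  · -- B = 0: X ≤ t A for all t, hence X ≤ 0
    rw [← hB0, mul_zero, Real.sqrt_zero]
    by_contra hX
    push Not at hX
    have ht : 0 < X / (2 * A) := by positivity
    have := h (X / (2 * A)) ht
    rw [← hB0, zero_div, add_zero] at this
    have h2 : X / (2 * A) * A = X / 2 := by field_simp
    rw [h2] at this
    linarith
  · -- A, B > 0: take t = √(B/A)/2
    set t : ℝ := Real.sqrt B / (2 * Real.sqrt A) with ht
    have hsA : 0 < Real.sqrt A := Real.sqrt_pos.mpr hApos
    have hsB : 0 < Real.sqrt B := Real.sqrt_pos.mpr hBpos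
    have htpos : 0 < t := by rw [ht]; positivity
    have := h t htpos
    have hval : t * A + B / (4 * t) = Real.sqrt (A * B) := by
      rw [ht, Real.sqrt_mul hA]
      field_simp
      rw [Real.sq_sqrt hA, Real.sq_sqrt hB]
      ring
    linarith

/-- `log X ≤ 2 √X` for `X > 0`. [folklore] -/
theorem log_le_two_mul_sqrt {X : ℝ} (hX : 0 < X) : Real.log X ≤ 2 * Real.sqrt X := by
  have hs : 0 < Real.sqrt X := Real.sqrt_pos.mpr hX
  have h := Real.log_le_sub_one_of_pos hs
  rw [Real.log_sqrt hX.le] at h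
  linarith

/-- `√(a + b) ≤ √a + √b` for `a, b ≥ 0`. [folklore] -/
theorem sqrt_add_le_sqrt_add_sqrt {a b : ℝ} (ha : 0 ≤ a) (hb : 0 ≤ b) :
    Real.sqrt (a + b) ≤ Real.sqrt a + Real.sqrt b := by
  rw [Real.sqrt_le_left (by positivity)]
  rw [add_sq, Real.sq_sqrt ha, Real.sq_sqrt hb]
  nlinarith [Real.sqrt_nonneg a, Real.sqrt_nonneg b]

/-- **The dyadic moment recursion closes, with a constant depending only on the parameters.**
For `C₁, K, L ≥ 0` and `A` there is `U > 0` such that every `M : ℕ → ℝ` with `M 0 = 1`,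
`1 ≤ M k`, `M (k+1) ≤ M k + C₁` and, for every `m ≥ 1`,
`M (4m) ≤ M (2m) + K m^{1/4} √(max 0 (A + L log (M (4m) / (2m)^{1/4})))`, satisfies
`M k ≤ U k^{1/4}` for all `k ≥ 1`. [folklore] -/
theorem moment_recursion_bound_uniform {C₁ K L A : ℝ} (hC₁ : 0 ≤ C₁) (hK : 0 ≤ K) (hL : 0 ≤ L) :
    ∃ U : ℝ, 0 < U ∧ ∀ M : ℕ → ℝ, M 0 = 1 → (∀ k, 1 ≤ M k) → (∀ k, M (k + 1) ≤ M k + C₁) →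
      (∀ m : ℕ, 1 ≤ m → M (4 * m) ≤ M (2 * m) +
        K * (m : ℝ) ^ ((1 : ℝ) / 4) * Real.sqrt (max 0 (A + L * Real.log (M (4 * m) / ((2 * m : ℕ) : ℝ) ^ ((1 : ℝ) / 4))))) →
      ∀ k : ℕ, 1 ≤ k → M k ≤ U * (k : ℝ) ^ ((1 : ℝ) / 4) := by
  -- constants
  set θ : ℝ := (2 : ℝ) ^ (-(1 : ℝ) / 4) with hθ
  have hθpos : 0 < θ := Real.rpow_pos_of_pos (by norm_num) _
  have hθ1 : θ < 1 := by
    rw [hθ]; exact Real.rpow_lt_one_of_one_lt_of_neg (by norm_num) (by norm_num)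
  set K₄ : ℝ := K * (4 : ℝ) ^ (-(1 : ℝ) / 4) with hK₄
  have hK₄nn : 0 ≤ K₄ := by rw [hK₄]; positivity
  set A₄ : ℝ := |A| + L / 4 * Real.log 2 with hA₄
  have hA₄nn : 0 ≤ A₄ := by rw [hA₄]; positivity
  set a₀ : ℝ := K₄ * Real.sqrt A₄ + 3 * C₁ with ha₀
  have ha₀nn : 0 ≤ a₀ := by rw [ha₀]; positivity
  set b₀ : ℝ := K₄ * Real.sqrt (2 * L) with hb₀
  have hb₀nn : 0 ≤ b₀ := by rw [hb₀]; positivity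
  set Ufix : ℝ := 2 * a₀ / (1 - θ) + (2 * b₀ / (1 - θ) + 1) ^ ((4 : ℝ) / 3) + 1 with hUfix
  have h1θ : 0 < 1 - θ := by linarith
  have hUfix1 : 1 ≤ Ufix := by
    rw [hUfix]
    have : 0 ≤ 2 * a₀ / (1 - θ) := by positivity
    have : 0 ≤ (2 * b₀ / (1 - θ) + 1) ^ ((4 : ℝ) / 3) := by positivity
    linarith
  -- the fixed-point property: for X ≥ Ufix, θ X + a₀ + b₀ X^{1/4} < X
  have hfix : ∀ X : ℝ, Ufix ≤ X → θ * X + a₀ + b₀ * X ^ ((1 : ℝ) / 4) < X := by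
    intro X hX
    have hXpos : 0 < X := lt_of_lt_of_le (lt_of_lt_of_le one_pos hUfix1) hX
    have hXa : 2 * a₀ / (1 - θ) < X := by
      rw [hUfix] at hX
      have : 0 ≤ (2 * b₀ / (1 - θ) + 1) ^ ((4 : ℝ) / 3) := by positivity
      linarith
    have ha : a₀ < (1 - θ) * X / 2 := by
      rw [div_lt_iff₀ h1θ] at hXa; linarith
    have hXb : (2 * b₀ / (1 - θ) + 1) ^ ((4 : ℝ) / 3) < X := by
      rw [hUfix] at hX
      have : 0 ≤ 2 * a₀ / (1 - θ) := by positivity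
      linarith
    -- X^{3/4} > 2 b₀/(1-θ)
    have hX34 : 2 * b₀ / (1 - θ) < X ^ ((3 : ℝ) / 4) := by
      have h1 : 2 * b₀ / (1 - θ) < 2 * b₀ / (1 - θ) + 1 := by linarith
      have h2 : (2 * b₀ / (1 - θ) + 1) = ((2 * b₀ / (1 - θ) + 1) ^ ((4 : ℝ) / 3)) ^ ((3 : ℝ) / 4) := by
        rw [← Real.rpow_mul (by positivity)]; norm_num
      have h3 : ((2 * b₀ / (1 - θ) + 1) ^ ((4 : ℝ) / 3)) ^ ((3 : ℝ) / 4) < X ^ ((3 : ℝ) / 4) :=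
        Real.rpow_lt_rpow (by positivity) hXb (by norm_num)
      linarith
    have hb : b₀ * X ^ ((1 : ℝ) / 4) ≤ (1 - θ) * X / 2 := by
      have hsplit : X = X ^ ((3 : ℝ) / 4) * X ^ ((1 : ℝ) / 4) := by
        rw [← Real.rpow_add hXpos]; norm_num
      have hX14 : 0 ≤ X ^ ((1 : ℝ) / 4) := Real.rpow_nonneg hXpos.le _
      have : b₀ ≤ (1 - θ) / 2 * X ^ ((3 : ℝ) / 4) := by
        rw [div_lt_iff₀ h1θ] at hX34
        linarith
      calc b₀ * X ^ ((1 : ℝ) / 4) ≤ ((1 - θ) / 2 * X ^ ((3 : ℝ) / 4)) * X ^ ((1 : ℝ) / 4) :=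
            mul_le_mul_of_nonneg_right this hX14
        _ = (1 - θ) * X / 2 := by
            conv_rhs => rw [hsplit]
            ring
    linarith
  -- φ bound: K₄ √(max 0 (A₄' + L log X)) ≤ K₄ (√A₄ + √(2L) X^{1/4}) for X > 0
  have hphi : ∀ X : ℝ, 0 < X →
      K₄ * Real.sqrt (max 0 (A + L / 4 * Real.log 2 + L * Real.log X)) ≤
        K₄ * Real.sqrt A₄ + b₀ * X ^ ((1 : ℝ) / 4) := by
    intro X hX
    have hlog := log_le_two_mul_sqrt hX
    have hmax : max 0 (A + L / 4 * Real.log 2 + L * Real.log X) ≤ A₄ + 2 * L * Real.sqrt X := by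
      refine max_le (by positivity) ?_
      rw [hA₄]
      have : L * Real.log X ≤ L * (2 * Real.sqrt X) := mul_le_mul_of_nonneg_left hlog hL
      linarith [le_abs_self A]
    have hsqrtsqrt : Real.sqrt (Real.sqrt X) = X ^ ((1 : ℝ) / 4) := by
      rw [Real.sqrt_eq_rpow, Real.sqrt_eq_rpow, ← Real.rpow_mul hX.le]; norm_num
    have hsqrt : Real.sqrt (max 0 (A + L / 4 * Real.log 2 + L * Real.log X)) ≤
        Real.sqrt A₄ + Real.sqrt (2 * L) * X ^ ((1 : ℝ) / 4) := by
      calc _ ≤ Real.sqrt (A₄ + 2 * L * Real.sqrt X) := Real.sqrt_le_sqrt hmax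
        _ ≤ Real.sqrt A₄ + Real.sqrt (2 * L * Real.sqrt X) := sqrt_add_le_sqrt_add_sqrt hA₄nn (by positivity)
        _ = Real.sqrt A₄ + Real.sqrt (2 * L) * X ^ ((1 : ℝ) / 4) := by
            rw [Real.sqrt_mul (by positivity), hsqrtsqrt]
    calc K₄ * Real.sqrt (max 0 (A + L / 4 * Real.log 2 + L * Real.log X))
        ≤ K₄ * (Real.sqrt A₄ + Real.sqrt (2 * L) * X ^ ((1 : ℝ) / 4)) := mul_le_mul_of_nonneg_left hsqrt hK₄nn
      _ = K₄ * Real.sqrt A₄ + b₀ * X ^ ((1 : ℝ) / 4) := by rw [hb₀]; ring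
  -- the bound U
  obtain ⟨U, hU⟩ : ∃ U : ℝ, U = max (1 + 7 * C₁) Ufix := ⟨_, rfl⟩
  have hU1 : 1 ≤ U := by rw [hU]; exact le_trans (by linarith) (le_max_left _ _)
  have hUpos : 0 < U := by linarith
  have hUfixU : Ufix ≤ U := by rw [hU]; exact le_max_right _ _
  have hUbase : 1 + 7 * C₁ ≤ U := by rw [hU]; exact le_max_left _ _
  have hUfixpt : θ * U + a₀ + b₀ * U ^ ((1 : ℝ) / 4) ≤ U := (hfix U hUfixU).le
  refine ⟨U, hUpos, fun M hM0 hM1 hstep hrec => ?_⟩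
  -- normalised sequence u k = M k / k^{1/4}
  have hMpos : ∀ k, 0 < M k := fun k => lt_of_lt_of_le one_pos (hM1 k)
  have hlin : ∀ k : ℕ, M k ≤ 1 + k * C₁ := by
    intro k
    induction k with
    | zero => rw [hM0]; simp
    | succ k ih => have := hstep k; push_cast; linarith
  -- the normalised recursion: u(4m) ≤ θ u(2m) + K₄ √(max 0 (A + L/4 log 2 + L log u(4m)))
  have hu_rec : ∀ m : ℕ, 1 ≤ m →
      M (4 * m) / ((4 * m : ℕ) : ℝ) ^ ((1 : ℝ) / 4) ≤
        θ * (M (2 * m) / ((2 * m : ℕ) : ℝ) ^ ((1 : ℝ) / 4)) +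
        K₄ * Real.sqrt (max 0 (A + L / 4 * Real.log 2 +
          L * Real.log (M (4 * m) / ((4 * m : ℕ) : ℝ) ^ ((1 : ℝ) / 4)))) := by
    intro m hm
    have hm0 : (0 : ℝ) < m := by exact_mod_cast hm
    have h4m : (0 : ℝ) < ((4 * m : ℕ) : ℝ) := by push_cast; positivity
    have h2m : (0 : ℝ) < ((2 * m : ℕ) : ℝ) := by push_cast; positivity
    have hp4 : 0 < ((4 * m : ℕ) : ℝ) ^ ((1 : ℝ) / 4) := Real.rpow_pos_of_pos h4m _
    have hp2 : 0 < ((2 * m : ℕ) : ℝ) ^ ((1 : ℝ) / 4) := Real.rpow_pos_of_pos h2m _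
    have h := hrec m hm
    -- identities between the powers
    have hpow4 : ((4 * m : ℕ) : ℝ) ^ ((1 : ℝ) / 4) = (4 : ℝ) ^ ((1 : ℝ) / 4) * (m : ℝ) ^ ((1 : ℝ) / 4) := by
      push_cast; exact Real.mul_rpow (by norm_num) hm0.le
    have hpow2 : ((2 * m : ℕ) : ℝ) ^ ((1 : ℝ) / 4) = (2 : ℝ) ^ ((1 : ℝ) / 4) * (m : ℝ) ^ ((1 : ℝ) / 4) := by
      push_cast; exact Real.mul_rpow (by norm_num) hm0.le
    have hm14 : 0 < (m : ℝ) ^ ((1 : ℝ) / 4) := Real.rpow_pos_of_pos hm0 _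
    have h2pos : 0 < (2 : ℝ) ^ ((1 : ℝ) / 4) := Real.rpow_pos_of_pos (by norm_num) _
    have h4pos : 0 < (4 : ℝ) ^ ((1 : ℝ) / 4) := Real.rpow_pos_of_pos (by norm_num) _
    -- the logarithms agree up to the constant (1/4) log 2
    have hlog : Real.log (M (4 * m) / ((2 * m : ℕ) : ℝ) ^ ((1 : ℝ) / 4)) =
        (1 : ℝ) / 4 * Real.log 2 + Real.log (M (4 * m) / ((4 * m : ℕ) : ℝ) ^ ((1 : ℝ) / 4)) := by
      rw [Real.log_div (hMpos _).ne' hp2.ne', Real.log_div (hMpos _).ne' hp4.ne', hpow4, hpow2,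
        Real.log_mul h4pos.ne' hm14.ne', Real.log_mul h2pos.ne' hm14.ne',
        Real.log_rpow (by norm_num : (0 : ℝ) < 4), Real.log_rpow (by norm_num : (0 : ℝ) < 2),
        show (4 : ℝ) = 2 ^ 2 by norm_num, Real.log_pow]
      ring
    -- divide the recursion by (4m)^{1/4}
    rw [div_le_iff₀ hp4]
    have h42 : (4 : ℝ) ^ ((1 : ℝ) / 4) = (2 : ℝ) ^ ((1 : ℝ) / 4) * (2 : ℝ) ^ ((1 : ℝ) / 4) := by
      rw [← Real.mul_rpow (by norm_num) (by norm_num)]; norm_num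
    have hneg : (2 : ℝ) ^ (-(1 : ℝ) / 4) * (2 : ℝ) ^ ((1 : ℝ) / 4) = 1 := by
      rw [← Real.rpow_add (by norm_num)]; norm_num
    have hratio : θ * ((4 * m : ℕ) : ℝ) ^ ((1 : ℝ) / 4) = ((2 * m : ℕ) : ℝ) ^ ((1 : ℝ) / 4) := by
      rw [hpow4, hpow2, hθ, h42]
      calc (2 : ℝ) ^ (-(1 : ℝ) / 4) * ((2 : ℝ) ^ ((1 : ℝ) / 4) * (2 : ℝ) ^ ((1 : ℝ) / 4) * (m : ℝ) ^ ((1 : ℝ) / 4))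
          = ((2 : ℝ) ^ (-(1 : ℝ) / 4) * (2 : ℝ) ^ ((1 : ℝ) / 4)) * ((2 : ℝ) ^ ((1 : ℝ) / 4) * (m : ℝ) ^ ((1 : ℝ) / 4)) := by
            ring
        _ = (2 : ℝ) ^ ((1 : ℝ) / 4) * (m : ℝ) ^ ((1 : ℝ) / 4) := by rw [hneg, one_mul]
    have hθ' : θ * (M (2 * m) / ((2 * m : ℕ) : ℝ) ^ ((1 : ℝ) / 4)) * ((4 * m : ℕ) : ℝ) ^ ((1 : ℝ) / 4) = M (2 * m) := by
      calc θ * (M (2 * m) / ((2 * m : ℕ) : ℝ) ^ ((1 : ℝ) / 4)) * ((4 * m : ℕ) : ℝ) ^ ((1 : ℝ) / 4)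
          = (θ * ((4 * m : ℕ) : ℝ) ^ ((1 : ℝ) / 4)) * M (2 * m) / ((2 * m : ℕ) : ℝ) ^ ((1 : ℝ) / 4) := by ring
        _ = ((2 * m : ℕ) : ℝ) ^ ((1 : ℝ) / 4) * M (2 * m) / ((2 * m : ℕ) : ℝ) ^ ((1 : ℝ) / 4) := by rw [hratio]
        _ = M (2 * m) := by field_simp
    have hK' : K₄ * Real.sqrt (max 0 (A + L / 4 * Real.log 2 + L * Real.log (M (4 * m) / ((4 * m : ℕ) : ℝ) ^ ((1 : ℝ) / 4)))) *
        ((4 * m : ℕ) : ℝ) ^ ((1 : ℝ) / 4) =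
        K * (m : ℝ) ^ ((1 : ℝ) / 4) * Real.sqrt (max 0 (A + L * Real.log (M (4 * m) / ((2 * m : ℕ) : ℝ) ^ ((1 : ℝ) / 4)))) := by
      have hneg4 : (4 : ℝ) ^ (-(1 : ℝ) / 4) * (4 : ℝ) ^ ((1 : ℝ) / 4) = 1 := by
        rw [← Real.rpow_add (by norm_num)]; norm_num
      have harg : A + L / 4 * Real.log 2 + L * Real.log (M (4 * m) / ((4 * m : ℕ) : ℝ) ^ ((1 : ℝ) / 4)) =
          A + L * ((1 : ℝ) / 4 * Real.log 2 + Real.log (M (4 * m) / ((4 * m : ℕ) : ℝ) ^ ((1 : ℝ) / 4))) := by ring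
      rw [hlog, hK₄, harg, hpow4]
      generalize Real.sqrt (max 0 (A + L * ((1 : ℝ) / 4 * Real.log 2 +
        Real.log (M (4 * m) / ((4 : ℝ) ^ ((1 : ℝ) / 4) * (m : ℝ) ^ ((1 : ℝ) / 4)))))) = S
      calc K * (4 : ℝ) ^ (-(1 : ℝ) / 4) * S * ((4 : ℝ) ^ ((1 : ℝ) / 4) * (m : ℝ) ^ ((1 : ℝ) / 4))
          = K * ((4 : ℝ) ^ (-(1 : ℝ) / 4) * (4 : ℝ) ^ ((1 : ℝ) / 4)) * (m : ℝ) ^ ((1 : ℝ) / 4) * S := by ring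
        _ = K * (m : ℝ) ^ ((1 : ℝ) / 4) * S := by rw [hneg4, mul_one]
    rw [add_mul, hθ', hK']
    exact h
  -- bounded increments over at most three steps
  have hgen : ∀ i j : ℕ, M (i + j) ≤ M i + j * C₁ := by
    intro i j
    induction j with
    | zero => simp
    | succ j ihj =>
      have := hstep (i + j)
      rw [← Nat.add_assoc]
      push_cast
      linarith
  -- strong induction on k for the normalised quantity
  suffices hmain : ∀ N k : ℕ, k ≤ N → 1 ≤ k → M k / (k : ℝ) ^ ((1 : ℝ) / 4) ≤ U by
    intro k hk
    have hk0 : (0 : ℝ) < k := by exact_mod_cast hk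
    have := hmain k k le_rfl hk
    rwa [div_le_iff₀ (Real.rpow_pos_of_pos hk0 _)] at this
  intro N
  induction N with
  | zero => intro k hk h1; omega
  | succ N ih =>
    intro k hkN hk1
    rcases Nat.lt_or_ge k (N + 1) with hlt | hge
    · exact ih k (by omega) hk1
    have hk0 : (0 : ℝ) < k := by exact_mod_cast hk1
    have hkpow : 1 ≤ (k : ℝ) ^ ((1 : ℝ) / 4) := Real.one_le_rpow (by exact_mod_cast hk1) (by norm_num)
    have hkpowpos : 0 < (k : ℝ) ^ ((1 : ℝ) / 4) := by linarith
    by_cases hsmall : k ≤ 7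
    · -- small k: M k ≤ 1 + 7 C₁ ≤ U
      rw [div_le_iff₀ hkpowpos]
      have h1 : M k ≤ 1 + k * C₁ := hlin k
      have h2 : (k : ℝ) * C₁ ≤ 7 * C₁ := mul_le_mul_of_nonneg_right (by exact_mod_cast hsmall) hC₁
      calc M k ≤ 1 + 7 * C₁ := by linarith
        _ ≤ U := hUbase
        _ ≤ U * (k : ℝ) ^ ((1 : ℝ) / 4) := le_mul_of_one_le_right hUpos.le hkpow
    · push Not at hsmall
      -- m = k / 4 ≥ 2, 4m ≤ k ≤ 4m + 3
      obtain ⟨m, hm⟩ : ∃ m : ℕ, m = k / 4 := ⟨_, rfl⟩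
      have hm1 : 1 ≤ m := by omega
      have h4mk : 4 * m ≤ k := by rw [hm]; exact Nat.mul_div_le k 4
      have hk4m : k < 4 * m + 4 := by omega
      have h2m_lt : 2 * m < k := by omega
      have h4m1 : 1 ≤ 4 * m := by omega
      have h2m1 : 1 ≤ 2 * m := by omega
      have h4m0 : (0 : ℝ) < ((4 * m : ℕ) : ℝ) := by exact_mod_cast (by omega : 0 < 4 * m)
      have hp4 : 0 < ((4 * m : ℕ) : ℝ) ^ ((1 : ℝ) / 4) := Real.rpow_pos_of_pos h4m0 _
      -- IH at 2m
      have ih2 : M (2 * m) / ((2 * m : ℕ) : ℝ) ^ ((1 : ℝ) / 4) ≤ U := ih (2 * m) (by omega) h2m1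
      -- M k ≤ M (4m) + 3 C₁
      have hMk : M k ≤ M (4 * m) + 3 * C₁ := by
        obtain ⟨j, hj⟩ : ∃ j, k = 4 * m + j := ⟨k - 4 * m, by omega⟩
        have hj3 : (j : ℝ) ≤ 3 := by exact_mod_cast (by omega : j ≤ 3)
        rw [hj]
        have h1 := hgen (4 * m) j
        have h2 : (j : ℝ) * C₁ ≤ 3 * C₁ := mul_le_mul_of_nonneg_right hj3 hC₁
        linarith
      -- u k ≤ u (4m) + 3 C₁
      have huk : M k / (k : ℝ) ^ ((1 : ℝ) / 4) ≤ M (4 * m) / ((4 * m : ℕ) : ℝ) ^ ((1 : ℝ) / 4) + 3 * C₁ := by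
        have hpowle : ((4 * m : ℕ) : ℝ) ^ ((1 : ℝ) / 4) ≤ (k : ℝ) ^ ((1 : ℝ) / 4) :=
          Real.rpow_le_rpow h4m0.le (by exact_mod_cast h4mk) (by norm_num)
        have hq : 0 ≤ M (4 * m) / ((4 * m : ℕ) : ℝ) ^ ((1 : ℝ) / 4) := div_nonneg (hMpos _).le hp4.le
        rw [div_le_iff₀ hkpowpos]
        have h1 : M (4 * m) = M (4 * m) / ((4 * m : ℕ) : ℝ) ^ ((1 : ℝ) / 4) * ((4 * m : ℕ) : ℝ) ^ ((1 : ℝ) / 4) := by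
          rw [div_mul_cancel₀ _ hp4.ne']
        have h2 : M (4 * m) / ((4 * m : ℕ) : ℝ) ^ ((1 : ℝ) / 4) * ((4 * m : ℕ) : ℝ) ^ ((1 : ℝ) / 4) ≤
            M (4 * m) / ((4 * m : ℕ) : ℝ) ^ ((1 : ℝ) / 4) * (k : ℝ) ^ ((1 : ℝ) / 4) :=
          mul_le_mul_of_nonneg_left hpowle hq
        have h3 : 3 * C₁ ≤ 3 * C₁ * (k : ℝ) ^ ((1 : ℝ) / 4) := le_mul_of_one_le_right (by positivity) hkpow
        calc M k ≤ M (4 * m) + 3 * C₁ := hMk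
          _ ≤ M (4 * m) / ((4 * m : ℕ) : ℝ) ^ ((1 : ℝ) / 4) * (k : ℝ) ^ ((1 : ℝ) / 4) + 3 * C₁ * (k : ℝ) ^ ((1 : ℝ) / 4) := by
              linarith
          _ = (M (4 * m) / ((4 * m : ℕ) : ℝ) ^ ((1 : ℝ) / 4) + 3 * C₁) * (k : ℝ) ^ ((1 : ℝ) / 4) := by ring
      -- the recursion at m, with the φ bound
      have hrec' := hu_rec m hm1
      obtain ⟨u4, hu4⟩ : ∃ u4 : ℝ, u4 = M (4 * m) / ((4 * m : ℕ) : ℝ) ^ ((1 : ℝ) / 4) := ⟨_, rfl⟩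
      rw [← hu4] at hrec' huk
      have hu4pos : 0 < u4 := by rw [hu4]; exact div_pos (hMpos _) hp4
      have hphi4 := hphi u4 hu4pos
      have hθih : θ * (M (2 * m) / ((2 * m : ℕ) : ℝ) ^ ((1 : ℝ) / 4)) ≤ θ * U :=
        mul_le_mul_of_nonneg_left ih2 hθpos.le
      have hineq : u4 ≤ θ * U + K₄ * Real.sqrt A₄ + b₀ * u4 ^ ((1 : ℝ) / 4) := by linarith
      by_cases hcase : 4 * m < k
      · -- IH also at 4m
        have ih4 : u4 ≤ U := by rw [hu4]; exact ih (4 * m) (by omega) h4m1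
        have hu4pow : b₀ * u4 ^ ((1 : ℝ) / 4) ≤ b₀ * U ^ ((1 : ℝ) / 4) :=
          mul_le_mul_of_nonneg_left (Real.rpow_le_rpow hu4pos.le ih4 (by norm_num)) hb₀nn
        have ha₀' : K₄ * Real.sqrt A₄ + 3 * C₁ = a₀ := by rw [ha₀]
        calc M k / (k : ℝ) ^ ((1 : ℝ) / 4) ≤ u4 + 3 * C₁ := huk
          _ ≤ θ * U + K₄ * Real.sqrt A₄ + b₀ * U ^ ((1 : ℝ) / 4) + 3 * C₁ := by linarith
          _ = θ * U + a₀ + b₀ * U ^ ((1 : ℝ) / 4) := by rw [← ha₀']; ring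
          _ ≤ U := hUfixpt
      · -- 4m = k
        have hk4 : k = 4 * m := by omega
        have huk' : M k / (k : ℝ) ^ ((1 : ℝ) / 4) = u4 := by rw [hu4, hk4]
        rw [huk']
        by_contra hgt
        push Not at hgt
        have hfx := hfix u4 (hUfixU.trans hgt.le)
        have hθu : θ * U ≤ θ * u4 := mul_le_mul_of_nonneg_left hgt.le hθpos.le
        have : K₄ * Real.sqrt A₄ ≤ a₀ := by rw [ha₀]; linarith
        linarith

/-- **The dyadic moment recursion closes.** Let `M : ℕ → ℝ` with `M 0 = 1`, `1 ≤ M k`,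
`M (k+1) ≤ M k + C₁`, and for every `m ≥ 1`
`M (4m) ≤ M (2m) + K m^{1/4} √(max 0 (A + L log (M (4m) / (2m)^{1/4})))`
(`C₁, K, L ≥ 0`). Then `M k ≤ U k^{1/4}` for all `k ≥ 1`, for some constant `U`. [folklore] -/
theorem moment_recursion_bound {M : ℕ → ℝ} {C₁ K L A : ℝ} (hC₁ : 0 ≤ C₁) (hK : 0 ≤ K) (hL : 0 ≤ L)
    (hM0 : M 0 = 1) (hM1 : ∀ k, 1 ≤ M k) (hstep : ∀ k, M (k + 1) ≤ M k + C₁)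
    (hrec : ∀ m : ℕ, 1 ≤ m → M (4 * m) ≤ M (2 * m) +
      K * (m : ℝ) ^ ((1 : ℝ) / 4) * Real.sqrt (max 0 (A + L * Real.log (M (4 * m) / ((2 * m : ℕ) : ℝ) ^ ((1 : ℝ) / 4))))) :
    ∃ U : ℝ, 0 < U ∧ ∀ k : ℕ, 1 ≤ k → M k ≤ U * (k : ℝ) ^ ((1 : ℝ) / 4) := by
  obtain ⟨U, hU, h⟩ := moment_recursion_bound_uniform (A := A) hC₁ hK hL
  exact ⟨U, hU, h M hM0 hM1 hstep hrec⟩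

end Literature.Probability.Process
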